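import Mathlib

/-!
# Dimock, *The renormalization group according to Balaban* II: the `B₀`-REPRODUCTION LEDGER of the active boundary terms
— the printed mechanism *"Terms which survive many steps must have a large extent and hence a tiny value"* (§3.13
Lemma 3.17) and the Conclusion of §3.18 — PROVED in its arithmetic with every smallness clause explicit and `k`-free

**Citation header (reproduction of PUBLISHED work; template of the Balaban lattice Yang–Mills cell).**
J. Dimock, *The renormalization group according to Balaban. II. Large fields*, J. Math. Phys. **54** (2013) 092301
(= arXiv:1212.5562v2) [Dimock2013BalabanII]: §3.1.1 "small field regions" (the separation scale `r_k = (−log λ_k)^r`,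
TeX L1651–1660), Theorem 3.1 \label{maintheorem} (§3.3), its item on the ACTIVE BOUNDARY TERM (TeX L2482–2497: *"|B_{k,π}(X)|
≤ B₀ λ_k^β e^{−κ d_M(X, mod Ω_k^c)}  for some constant B₀ depending on L, M"*), §3.13 "localization" Lemma 3.17
\label{third} (TeX L5163–5373) and §3.18 "final localization" (TeX L6045–6445: Lemma 3.22 with (lulu) L6054–6070, Lemma
3.23 with (lulu2) L6278–6291, the three pieces B^{(0)}/B^{*(0)} (L6305–6344), B^{*,(1)} (L6348–6357), B^{*,(2)} (L6365–6410),
and the Conclusion L6414–6429).  TeX line numbers refer to the arXiv source held by the cell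
(`inputs/files/dimock/src/1212.5562/1212.5562.tex`, 7217 lines, sha256[:16] 75c5792fc48eacbc; arXiv subsection and
`[section]`-counter lemma numbering, cell TEMPLATE.md CHANGES v2 (b)).

**What the paper prints (verbatim).**  L1651–1656: *"Define r_k = r(λ_k) = (−log λ_k)^r = ((N−k) log L − log λ)^r for
some postive* ⟦sic⟧ *integer r.  We assume always λ_k is small so −log λ_k > 0 is large and r_k is large and decreasing in
k. The separation requirement is that d((Λ̄_{j−1})^c, Ω_j) ≥ 5[r_j]L^{−(k−j)}M,  d(Ω_j^c, Λ_j) ≥ 5[r_j]L^{−(k−j)}M"*.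
L5338–5339 (inside the proof of Lemma 3.17): *"|(B_{k,π⁺})″(Z)| ≤ 𝒪(1)L³B₀λ_k^β e^{−L(κ−κ₀−2)d_{LM}(Z, mod Ω^c_{k+1})}"*;
**L5359–5371**: *"Now consider terms in (spitoon2) with Z # Λ_{k+1}. … Since also Z # Λ_k we have Z # Ω_{k+1} and so Z
must have cubes in Ω_{k+1} on the boundary and in Λ_{k+1}, and these are necessarily a distance at least r_{k+1}LM
apart. Then any tree joining the LM cubes in Z ∩ Ω_{k+1} must have length at least r_{k+1}LM. Hence LMd_{LM}(Z, mod
Ω^c_{k+1}) ≥ LMr_{k+1} and therefore d_{LM}(Z, mod Ω^c_{k+1}) ≥ r_{k+1}. We use this to extract a tiny factor e^{−r_{k+1}}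
leaving say e^{−L(κ−κ₀−3)d_M(Z, mod Ω^c_k)}.  Then for λ_k sufficiently small take 𝒪(1)L³B₀λ_k^β e^{−r_{k+1}} ≤ λ_k^{n₀}.
This is the basic mechanism which keeps the boundary terms from growing. Terms which survive many steps must have a
large extent and hence a tiny value. Altogether then we have the announced bound |B^{(B)}_{k,π⁺}(Z)| ≤ λ_k^{n₀}
e^{−L(κ−κ₀−3)d_{LM}(Z, mod Ω^c_{k+1})}"*.  §3.18, (lulu) L6066–6067: *"|R_{k+1,π⁺}(X)| ≤ λ_{k+1}^{n₀} e^{−κd_M(X)},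
|B^{*,(R)}_{k+1,π⁺}(X)| ≤ 𝒪(1)λ_{k+1}^{n₀} e^{−κd_M(X, mod Ω^c_{k+1})}"*; (lulu2) L6289: *"|(B^*_{k+1,π⁺})′(X)| ≤ ½B₀
λ_{k+1}^β e^{−κd_M(X, mod Ω^c_{k+1})}"*; L6300: *"B^*_{k+1,π⁺} has three parts which we consider separately"*; the term
B^{(0)} = [(B^#_k)_{L^{−1}}]_{π⁺}(Λ_{k+1}) (L6305), L6314–6318: *"since β < ¼ − 10ε and λ_k < λ_{k+1} we have the bound
… |B^{(0)}_{k+1,π⁺}(X)| ≤ 𝒪(1)L³λ_{k+1}^β e^{−L(κ−6κ₀−6)d_M(X, mod Ω^c_{k+1})}"*, L6341–6344: *"|(B^{*(0)}_{k+1,π⁺})′(Z)| ≤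
𝒪(1)L³λ_{k+1}^β e^{−L(κ−8κ₀−8)d_M(Z, mod Ω^c_{k+1})} ≤ ¼B₀λ_{k+1}^β e^{−κd_M(Z, mod Ω^c_{k+1})}  We have assumed B₀ is
sufficiently large so that 𝒪(1)L³ ≤ ¼B₀"*; B^{*,(1)} L6348: *"This is similar to the previous case"* (with L6354:
*"|B^{*,(1)}_{k+1,π⁺}(Z₀)| ≤ L³λ_k^β e^{−L(κ−κ₀−1)d_M(Z₀)}"*); B^{*,(2)} L6401: *"|B^{*,(2)}_{k+1,π⁺}(X)| ≤ 𝒪(1)L³λ_{k+1}^β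
e^{−2κd_M(X)}"*, L6405–6407: *"Now localize as before and get … |(B^{*(2)}_{k+1,π⁺})′(Z)| ≤ ¼B₀λ_{k+1}^β e^{−κd_M(Z, mod
Ω^c_{k+1})}"*; L6410: *"The lemma now holds with (B^*_{k+1,π⁺})′(Z) = (B^{*(0)}_{k+1,π⁺})′(Z) + … + (B^{*(2)}_{k+1,π⁺})′(Z)"*;
**Conclusion** L6414–6429: *"B_{k+1,π⁺}(X) = B^{*,(R)}_{k+1,π⁺}(X) + (B^*_{k+1,π⁺})′(X) … satisfies there |B_{k+1,π⁺}(X)| ≤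
(𝒪(1)λ_{k+1}^{n₀} + ½B₀λ_{k+1}^β) e^{−κd_M(X, mod Ω^c_{k+1})} ≤ B₀λ_{k+1}^β e^{−κd_M(X, mod Ω^c_{k+1})}"*.  Context:
Theorem 3.1's clause (TeX L2389) *"Let L be sufficiently large, let M be sufficiently large (depending on L), and let λ_k
be sufficiently small (depending on L, M)"*; `λ_{k+1} = Lλ_k` (part I; used at L6314 *"λ_k < λ_{k+1}"*); the tiny-term
exponent *"a fixed integer n₀ ≥ 4"* (L2475) and *"β < ¼ − 10ε"* (L2463); and, in §3.13 (proof of Lemma 3.16), L4962: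
*"(since e^{−r_{k+1}} = 𝒪(λ_k^n) for any n)"*.  For CONTRAST (Part 7), the TINY terms of the same §3.18, L6112–6119, verbatim:
*"We assume that κ is sufficiently large such that L(κ−8κ₀−8) ≥ κ. (It suffices for example that κ ≥ 16κ₀+16). Then the
exponent is dominated by e^{−κd_M(Z)}. Furthermore for L sufficiently large and n₀ ≥ 4  𝒪(1)L³λ_k^{n₀} = 𝒪(1)L^{3−n₀}
λ_{k+1}^{n₀} ≤ ⅙λ_{k+1}^{n₀}  This is why we chose n₀ ≥ 4. This is the basic mechanism which keeps the tiny terms tiny, in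
spite of the growth factor L³. Thus the bound is |(R^{*(0)}_{k+1,π⁺})′(Z)| ≤ ⅙λ_{k+1}^{n₀} e^{−κd_M(Z)}"*.

**Why this file (cell TEMPLATE.md §14.6 T-G16).**  T-G16 is the standing objection on B14 §3 (cell GAPS.md G-B14s-18:
*"constant reproduction / uniformity in k not displayed — THE objection of Sect. 3"*): how the boundary-term constant
`B₀` of the inductive hypothesis is REPRODUCED, not accumulated, when the old boundary terms are carried through a step
and new ones are added.  The template's answer for its OWN model is the passage L5359–5371 + L6414–6429 above.  This
module TYPES that answer as real arithmetic over abstract quantities — NOTHING of the model (polymers, fields, norms)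
enters — so that every smallness clause is explicit and VISIBLY independent of the step index `k`.

**What is reproduced here (kernel-checked, zero `sorry`).**
* Part 1 — the separation scale `rsep r λ = (−log λ)^r`; `exp_neg_rsep_le_rpow` (*"e^{−r_{k+1}} = 𝒪(λ_k^n) for any n"*,
  L4962, explicit: `e^{−r(λ)} ≤ λ^n` once `r ≥ 2` and `−log λ ≥ max(1, n)`); the elementary fact behind *"extract a tiny
  factor"*: `survival_abstract` (`A s + B ≤ s^r` once `r ≥ 2`, `s ≥ 1`, `s ≥ A + √B`), and **`survival`**: for `λ_{k+1} =
  Lλ_k`, `L ≥ 1`, `β ≤ n₀`, `r ≥ 2` and `−log λ_{k+1} ≥ s₀ := max(1, (n₀−β) + √(max(0, (n₀−β) log L + log(CL³B₀))))`: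
  **`C L³ B₀ λ_k^β e^{−r(λ_{k+1})} ≤ λ_k^{n₀}`** — the print's *"for λ_k sufficiently small take 𝒪(1)L³B₀λ_k^β e^{−r_{k+1}}
  ≤ λ_k^{n₀}"* with the threshold written out; it mentions `k` only through `λ_{k+1} ≤ e^{−s₀}`.
* Part 2 — **`old_term_tiny`** (L5338–5371): a surviving old term `|v| ≤ C L³ B₀ λ_k^β e^{−L(κ−κ₀−2)d}` whose polymer
  has extent `d ≥ r_{k+1}` (the geometric input, a HYPOTHESIS here) satisfies `|v| ≤ λ_k^{n₀} e^{−L(κ−κ₀−3)d}`.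
* Part 3 — **`new_term_fraction`** / `new_term_quarter` (L6341–6344; L6407): a NEW boundary piece `|v| ≤ C L³ λ^β e^{−κ′d}`
  with `κ′ ≥ κ` (`κ′ = L(κ−8κ₀−8)` under the rate clause `κ ≤ L(κ−8κ₀−8)`) is `≤ θB₀ λ^β e^{−κd}` once `C L³ ≤ θB₀` — its
  constant is `B₀`-free, so ONE choice of `B₀` absorbs it (*"𝒪(1)L³ ≤ ¼B₀"*); `rpow_step_mono` (L6314: `λ_k^β ≤ λ_{k+1}^β`).
* Part 4 — **`conclusion_step`** (L6427–6428) for an arbitrary total fraction `θ′`: `C′λ^{n₀} + θ′B₀λ^β ≤ B₀λ^β` from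
  `C′λ^{n₀−β} ≤ (1−θ′)B₀`, and the explicit smallness `lam_small_of_le` making the latter hold.
* Part 5 — the LEDGER `Clauses` (`L ≥ 1`; `C L³ ≤ θB₀` per piece with `3θ < 1`; the rate clause; `r ≥ 2`; `0 ≤ β < n₀`;
  the survival threshold at `λ_max`; the conclusion smallness `C′λ_max^{n₀−β} ≤ (1−3θ)B₀` — NONE mentions `k`),
  `clauses_inhabited` (for any `𝒪(1)` constants, `L ≥ 1` with the rate clause, `0 ≤ β < n₀`, `0 < θ < ⅓`, `r ≥ 2`, the
  clauses hold with `B₀ := CL³/θ` and an explicit `λ_max`), `survive_every_step` / `old_term_tiny_every_step` (the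
  survival clause and Lemma 3.17's tininess at EVERY step `λ_k ≤ λ_max`), and the assembled step **`B0_reproduced`**: for
  EVERY `k` (`0 < λ_k ≤ λ_{k+1} ≤ λ_max`), the printed per-piece bounds at step `k → k+1` (hypotheses, the four pieces of
  L6422/L6410 as abstract reals, the new pieces with `B₀`-free constants `C L³` and rates `≥ κ`) give `|B_{k+1}(X)| ≤ B₀
  λ_{k+1}^β e^{−κ d(X)}` with the SAME `B₀`; `quarter_fractions`: the print's `θ = ¼`, `1 − 3θ = ¼`.
* Part 6 — two LOCATED precisions (records only; Dimock-internal): `r_one_forces_lower_bound` / `r_one_fails_for_small` —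
  with `r = 1` (`e^{−r_{k+1}} = λ_{k+1} = Lλ_k`, `exp_neg_rsep_one`) the survival clause at L5367 reads `CL⁴B₀ ≤
  λ_k^{n₀−1−β}`, a LOWER bound on the coupling, violated by all small `λ_k` when `n₀ > 1 + β` (here `n₀ ≥ 4`, `β < ¼`) —
  consistent with L4962 *"e^{−r_{k+1}} = 𝒪(λ_k^n) for any n"*, which is exactly the case `r ≥ 2`; so *"some postive integer
  r"* (L1655) is to be read `r ≥ 2` (as in `Clauses`); and the FRACTIONS: `(B^{*(0)})′` and `(B^{*(2)})′` are printed at `¼B₀`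
  each (L6342, L6407) with `(B^{*(1)})′` *"similar"* (L6348) — three quarters — while (lulu2) (L6289) and the first member
  of the Conclusion (L6427) carry `½B₀`; immaterial to the reproduction: with `¾` the Conclusion closes under `𝒪(1)
  λ_{k+1}^{n₀−β} ≤ ¼B₀` (`conclusion_three_quarters`), or the print's `½` holds with each piece at `⅙B₀` (`sixth_fractions`).
* Part 7 (v1.1) — CONTRAST, the TINY terms (L6112–6119): `rate_clause_of_sixteen` (*"It suffices for example that κ ≥
  16κ₀+16"* ⇒ `κ ≤ L(κ−8κ₀−8)` for `L ≥ 2`, `κ₀ ≥ 0` — the rate clause of `Clauses`), `tiny_term_scaling` (the printed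
  identity `CL³λ_k^{n₀} = CL^{3−n₀}λ_{k+1}^{n₀}`) and **`tiny_term_sixth`** (`CL³λ_k^{n₀} ≤ ⅙λ_{k+1}^{n₀}` once `6C ≤ L^{n₀−3}`
  — *"This is why we chose n₀ ≥ 4"*): THIS device is a power `L^{3−n₀}` of the coupling RATIO `λ_k/λ_{k+1} = L^{−1}`
  (superrenormalizability), whereas in Parts 2–5 the ratio enters only additively (`(n₀−β) log L` inside the survival
  threshold) and monotonically (`λ_k^β ≤ λ_{k+1}^β`) — the distinction recorded in cell TEMPLATE.md §14.6 T-G16 ADDENDUM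
  (v8.38).

**What is NOT claimed.**  Nothing of the model: the per-piece bounds (L5338, L6316, L6340, L6354, L6405), the geometric
input `d_{LM}(Z, mod Ω^c_{k+1}) ≥ r_{k+1}` (L5361–5363; the separation built into `Ω_{k+1}` at L2726–2727) and the rate
bookkeeping of reblocking are HYPOTHESES here (their combinatorial parts are kernel elsewhere in this directory:
`Reblocking`, `ThreeSortedResummation`, `HoleSummability`, `ConnectedPolymerSums`); nothing about [Dimock2013BalabanII]
beyond the cited lines; nothing about any Bałaban paper — B14's `R_k`, `LMR_{k+1}`-cubes and (2.38)–(2.47) are the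
sub-cells' (TEMPLATE §14.2/§14.6; GAPS G-B14s-18, G-B14s-22, G-B14s-23, G-sb14-4).  What the ledger OFFERS the B14 seats is the typed
SHAPE of a `k`-uniform reproduction: (i) old boundary terms that still touch the new small-field region have extent ≥ the
separation scale `R`, so the factor `e^{−R}` beats `B₀`, the reblocking growth `𝒪(1)L³` and the step `λ_k^{n₀} =
L^{−n₀}λ_{k+1}^{n₀}` provided `R ≥ (n₀−β)(−log λ_{k+1}) + (n₀−β) log L + log(𝒪(1)L³B₀)` — a condition on the separation
scale vs the coupling, not on `k`; (ii) new boundary terms are `B₀`-free and are absorbed by choosing `B₀ ≥ 𝒪(1)L³/θ`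
ONCE.  Dimock's papers are published and refereed and are the cell's TEMPLATE, not manuscripts under audit.  Value = the template mechanism for T-G16 typed with explicit, `k`-free clauses; NOT summit progress.

Cell records: TEMPLATE.md §14.6 T-G16 ADDENDUM (v8.38) / §4.2; GAPS C-tmpl26-5; unit `b2b-balaban-template` gen 26, journal
claim D2-B0-LEDGER.  Leaf (v1 p192994; v1.1 adds Part 7 and two citations, statements of v1 unchanged); imports Mathlib
only; modifies nothing.
-/

noncomputable section

open Real

namespace Literature.MathematicalPhysics.QuantumFieldTheory.Dimock2011to13.BoundaryTermLedger

/-! ## Part 1. The separation scale `r_k = (−log λ_k)^r` and the survival inequality -/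

/-- `r(λ) = (−log λ)^r` — [Dimock2013BalabanII] §3.1.1, verbatim: *"Define r_k = r(λ_k) = (−log λ_k)^r = ((N−k) log L −
log λ)^r for some postive* ⟦sic⟧ *integer r."*  (The integer part `[r_j]` in the scale variables `(L, λ, N, j)` is
`RegionVolume.lay` of `LargeFieldRegionVolume`; here `r(·)` is a function of the running coupling itself, cf. `rsep_scale`.)
[cite: Dimock2013BalabanII, §3.1.1 (arXiv:1212.5562v2 TeX L1651–1655)] -/
def rsep (r : ℕ) (lam : ℝ) : ℝ := (-Real.log lam) ^ r

/-- `r(λ) = ((N−k) log L − log λ)^r` at `λ_k = L^{−(N−k)}λ`.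
[cite: Dimock2013BalabanII, §3.1.1 (arXiv:1212.5562v2 TeX L1653)] -/
theorem rsep_scale (r N k : ℕ) {L lam : ℝ} (hL : 0 < L) (hlam : 0 < lam) :
    rsep r (L ^ (-((N : ℝ) - k)) * lam) = (((N : ℝ) - k) * Real.log L - Real.log lam) ^ r := by
  unfold rsep
  rw [Real.log_mul (by positivity) hlam.ne', Real.log_rpow hL]
  ring_nf

/-- *"−log λ_k > 0 is large and r_k is large"*: `r(λ) > 0` for `0 < λ < 1`.
[cite: Dimock2013BalabanII, §3.1.1 (arXiv:1212.5562v2 TeX L1656)] -/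
theorem rsep_pos (r : ℕ) {lam : ℝ} (h0 : 0 < lam) (h1 : lam < 1) : 0 < rsep r lam := by
  unfold rsep
  exact pow_pos (by linarith [Real.log_neg h0 h1]) r

/-- *"r_k is … decreasing in k"*: `r(·)` is antitone on `(0,1)` (and `λ_k` increases with `k`).
[cite: Dimock2013BalabanII, §3.1.1 (arXiv:1212.5562v2 TeX L1656)] -/
theorem rsep_antitone (r : ℕ) {a b : ℝ} (ha : 0 < a) (hab : a ≤ b) (hb : b < 1) : rsep r b ≤ rsep r a := by
  unfold rsep
  have hlb : Real.log b < 0 := Real.log_neg (lt_of_lt_of_le ha hab) hb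
  exact pow_le_pow_left₀ (by linarith) (by linarith [Real.log_le_log ha hab]) r

/-- *"(since e^{−r_{k+1}} = 𝒪(λ_k^n) for any n)"* — [Dimock2013BalabanII] §3.13, EXPLICIT: for `r ≥ 2`, `0 < λ` and
`−log λ ≥ max(1, n)` one has `e^{−r(λ)} ≤ λ^n` (at `λ = λ_{k+1} = Lλ_k` this is `≤ L^n λ_k^n`).
[cite: Dimock2013BalabanII, §3.13, proof of Lemma 3.16 (arXiv:1212.5562v2 TeX L4962)] -/
theorem exp_neg_rsep_le_rpow {r : ℕ} (hr : 2 ≤ r) {lam n : ℝ} (hlam : 0 < lam) (h1 : 1 ≤ -Real.log lam)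
    (hn : n ≤ -Real.log lam) : Real.exp (-rsep r lam) ≤ lam ^ n := by
  rw [Real.rpow_def_of_pos hlam, Real.exp_le_exp]
  unfold rsep
  set s := -Real.log lam with hs
  have hlog : Real.log lam = -s := by rw [hs]; ring
  rw [hlog]
  have hs2 : s ^ 2 ≤ s ^ r := pow_le_pow_right₀ h1 hr
  nlinarith

/-- … which FAILS for `r = 1`: `e^{−r(λ)} = λ` when `r = 1` (so `e^{−r_{k+1}} = λ_{k+1} = Lλ_k` is not `𝒪(λ_k^n)` for
`n > 1`). [cite: Dimock2013BalabanII, §3.1.1 (arXiv:1212.5562v2 TeX L1653–1655)] -/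
theorem exp_neg_rsep_one {lam : ℝ} (hlam : 0 < lam) : Real.exp (-rsep 1 lam) = lam := by
  unfold rsep; rw [pow_one, neg_neg, Real.exp_log hlam]

/-- The elementary inequality behind *"extract a tiny factor e^{−r_{k+1}}"*: for `r ≥ 2`, `s ≥ 1`, `A, B ≥ 0` and
`s ≥ A + √B` one has `A·s + B ≤ s^r`. [folklore] -/
theorem survival_abstract {r : ℕ} (hr : 2 ≤ r) {s A B : ℝ} (hs1 : 1 ≤ s) (hA : 0 ≤ A) (hB : 0 ≤ B)
    (hs : A + Real.sqrt B ≤ s) : A * s + B ≤ s ^ r := by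
  have hsq : Real.sqrt B * Real.sqrt B = B := Real.mul_self_sqrt hB
  have hsB : Real.sqrt B ≤ s := by linarith [Real.sqrt_nonneg B]
  have h2 : A * s + B ≤ s ^ 2 := by nlinarith [Real.sqrt_nonneg B]
  exact h2.trans (pow_le_pow_right₀ hs1 hr)

/-- The EXPLICIT threshold `s₀(n₀ − β, log L, log(CL³B₀))` for `−log λ_{k+1}`. [folklore] -/
def sThreshold (A logL logK : ℝ) : ℝ := max 1 (A + Real.sqrt (max 0 (A * logL + logK)))

/-- `s₀ ≥ 1`. [folklore] -/
theorem one_le_sThreshold (A logL logK : ℝ) : 1 ≤ sThreshold A logL logK := le_max_left _ _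

/-- **THE SURVIVAL CLAUSE, EXPLICIT** — [Dimock2013BalabanII] §3.13, verbatim: *"Then for λ_k sufficiently small take
𝒪(1)L³B₀λ_k^β e^{−r_{k+1}} ≤ λ_k^{n₀}"* — PROVED for `λ_{k+1} = Lλ_k`, `L ≥ 1`, `β ≤ n₀`, `r ≥ 2`, under the
`k`-FREE threshold `−log λ_{k+1} ≥ s₀ = max(1, (n₀−β) + √(max(0, (n₀−β) log L + log(CL³B₀))))` (which already
forces `λ_{k+1} ≤ e^{−1}`; the sign of `β` is not used).
[cite: Dimock2013BalabanII, §3.13 Lemma 3.17 proof (arXiv:1212.5562v2 TeX L5367)] -/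
theorem survival {r : ℕ} (hr : 2 ≤ r) {C B₀ L β n₀ lamk lamk1 : ℝ} (hC : 0 < C) (hB₀ : 0 < B₀) (hL : 1 ≤ L)
    (hlamk : 0 < lamk) (hstep : lamk1 = L * lamk) (hβn : β ≤ n₀)
    (hs : sThreshold (n₀ - β) (Real.log L) (Real.log (C * L ^ 3 * B₀)) ≤ -Real.log lamk1) :
    C * L ^ 3 * B₀ * lamk ^ β * Real.exp (-rsep r lamk1) ≤ lamk ^ n₀ := by
  have hL0 : 0 < L := by linarith
  have hK : 0 < C * L ^ 3 * B₀ := by positivity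
  have hlamk1pos : 0 < lamk1 := by rw [hstep]; positivity
  set s := -Real.log lamk1 with hs_def
  set A := n₀ - β with hA_def
  have hA : 0 ≤ A := by rw [hA_def]; linarith
  have hlogL : 0 ≤ Real.log L := Real.log_nonneg hL
  -- the threshold consequences
  have hs1 : 1 ≤ s := (one_le_sThreshold _ _ _).trans hs
  have hsAB : A + Real.sqrt (max 0 (A * Real.log L + Real.log (C * L ^ 3 * B₀))) ≤ s := (le_max_right _ _).trans hs
  have key : A * s + max 0 (A * Real.log L + Real.log (C * L ^ 3 * B₀)) ≤ s ^ r :=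
    survival_abstract hr hs1 hA (le_max_left _ _) hsAB
  have key' : A * s + (A * Real.log L + Real.log (C * L ^ 3 * B₀)) ≤ s ^ r :=
    le_trans (by linarith [le_max_right (0:ℝ) (A * Real.log L + Real.log (C * L ^ 3 * B₀))]) key
  -- logs of the two sides
  have hloglamk : Real.log lamk = Real.log lamk1 - Real.log L := by
    rw [hstep, Real.log_mul hL0.ne' hlamk.ne']; ring
  have hrs : rsep r lamk1 = s ^ r := rfl
  rw [Real.rpow_def_of_pos hlamk, Real.rpow_def_of_pos hlamk, ← Real.exp_log hK, ← Real.exp_add, ← Real.exp_add,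
    Real.exp_le_exp, hrs, hloglamk]
  -- goal: log K + (log lamk1 - log L) * β + -s^r ≤ (log lamk1 - log L) * n₀, with log lamk1 = -s
  have hl1 : Real.log lamk1 = -s := by rw [hs_def]; ring
  rw [hl1]
  nlinarith [key', hA, hlogL, hs1]

/-! ## Part 2. Old boundary terms that survive the step: *"large extent and hence a tiny value"* -/

/-- Rate bookkeeping of *"We use this to extract a tiny factor e^{−r_{k+1}} leaving say e^{−L(κ−κ₀−3)d_M(Z, mod Ω^c_k)}"*:
for `0 ≤ r ≤ d`, `L ≥ 1`, `e^{−L(κ−κ₀−2)d} ≤ e^{−r} · e^{−L(κ−κ₀−3)d}`.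
[cite: Dimock2013BalabanII, §3.13 Lemma 3.17 proof (arXiv:1212.5562v2 TeX L5364–5365)] -/
theorem exp_rate_split {L κ κ₀ d r : ℝ} (hL : 1 ≤ L) (hd : 0 ≤ d) (hdr : r ≤ d) :
    Real.exp (-(L * (κ - κ₀ - 2)) * d) ≤ Real.exp (-r) * Real.exp (-(L * (κ - κ₀ - 3)) * d) := by
  rw [← Real.exp_add, Real.exp_le_exp]
  nlinarith

/-- **OLD TERMS ARE TINY** — [Dimock2013BalabanII] §3.13 Lemma 3.17, the passage L5338–5371 assembled: a surviving old
boundary term with `|v| ≤ 𝒪(1)L³B₀λ_k^β e^{−L(κ−κ₀−2)d}` (L5338) on a polymer of extent `d = d_{LM}(Z, mod Ω^c_{k+1}) ≥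
r_{k+1}` (L5361–5363, a hypothesis here), under the survival clause (Part 1), satisfies **`|v| ≤ λ_k^{n₀} e^{−L(κ−κ₀−3)d}`**
(L5370–5371). [cite: Dimock2013BalabanII, §3.13 Lemma 3.17 (arXiv:1212.5562v2 TeX L5338–5371)] -/
theorem old_term_tiny {v C L B₀ β n₀ κ κ₀ d rk1 lamk : ℝ} (hL : 1 ≤ L) (hlamk : 0 < lamk)
    (hv : |v| ≤ C * L ^ 3 * B₀ * lamk ^ β * Real.exp (-(L * (κ - κ₀ - 2)) * d))
    (hCpos : 0 ≤ C * L ^ 3 * B₀) (hd : 0 ≤ d) (hext : rk1 ≤ d)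
    (hsurv : C * L ^ 3 * B₀ * lamk ^ β * Real.exp (-rk1) ≤ lamk ^ n₀) :
    |v| ≤ lamk ^ n₀ * Real.exp (-(L * (κ - κ₀ - 3)) * d) := by
  have hpre : 0 ≤ C * L ^ 3 * B₀ * lamk ^ β := mul_nonneg hCpos (Real.rpow_nonneg hlamk.le β)
  calc |v| ≤ C * L ^ 3 * B₀ * lamk ^ β * Real.exp (-(L * (κ - κ₀ - 2)) * d) := hv
    _ ≤ C * L ^ 3 * B₀ * lamk ^ β * (Real.exp (-rk1) * Real.exp (-(L * (κ - κ₀ - 3)) * d)) :=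
        mul_le_mul_of_nonneg_left (exp_rate_split hL hd hext) hpre
    _ = (C * L ^ 3 * B₀ * lamk ^ β * Real.exp (-rk1)) * Real.exp (-(L * (κ - κ₀ - 3)) * d) := by ring
    _ ≤ lamk ^ n₀ * Real.exp (-(L * (κ - κ₀ - 3)) * d) :=
        mul_le_mul_of_nonneg_right hsurv (Real.exp_pos _).le

/-! ## Part 3. New boundary terms: `B₀`-free, absorbed by `𝒪(1)L³ ≤ θB₀` -/

/-- Rate bookkeeping: `e^{−κ′d} ≤ e^{−κd}` for `d ≥ 0` once `κ ≤ κ′` — used with `κ′ = L(κ−8κ₀−8)` (L6341–6342, the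
rate clause `κ ≤ L(κ−8κ₀−8)` being a condition on `κ, κ₀, L` only) and with `κ′ = 2κ` (L6401). [folklore] -/
theorem exp_rate_mono {κ κ' d : ℝ} (hd : 0 ≤ d) (hrate : κ ≤ κ') : Real.exp (-κ' * d) ≤ Real.exp (-κ * d) := by
  rw [Real.exp_le_exp]; nlinarith

/-- *"since β < ¼ − 10ε and λ_k < λ_{k+1} we have the bound"* with `λ_{k+1}^β` in place of `λ_k^β` (L6314–6315; used for
the piece B^{*,(1)}, printed with `λ_k^β` at L6354): `λ_k^β ≤ λ_{k+1}^β` for `0 < λ_k ≤ λ_{k+1}`, `β ≥ 0`.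
[cite: Dimock2013BalabanII, §3.18 (arXiv:1212.5562v2 TeX L6314–6315)] -/
theorem rpow_step_mono {lamk lam1 β : ℝ} (hlamk : 0 < lamk) (hkk1 : lamk ≤ lam1) (hβ : 0 ≤ β) :
    lamk ^ β ≤ lam1 ^ β :=
  Real.rpow_le_rpow hlamk.le hkk1 hβ

/-- **NEW TERMS ARE A FRACTION OF `B₀`** — [Dimock2013BalabanII] §3.18, verbatim: *"|(B^{*(0)}_{k+1,π⁺})′(Z)| ≤ 𝒪(1)L³
λ_{k+1}^β e^{−L(κ−8κ₀−8)d_M(Z, mod Ω^c_{k+1})} ≤ ¼B₀λ_{k+1}^β e^{−κd_M(Z, mod Ω^c_{k+1})}  We have assumed B₀ is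
sufficiently large so that 𝒪(1)L³ ≤ ¼B₀"* — PROVED for an arbitrary fraction `θ` (`C L³ ≤ θ B₀`) in place of `¼` and
an arbitrary rate `κ′ ≥ κ` in place of `L(κ−8κ₀−8)`: the constant in front of a NEW boundary piece does not contain `B₀`,
so it is absorbed by the ONE choice `B₀ ≥ C L³/θ`. [cite: Dimock2013BalabanII, §3.18 (arXiv:1212.5562v2 TeX L6340–6344)] -/
theorem new_term_fraction {v C L B₀ θ β κ κ' d lam : ℝ} (hlam : 0 < lam) (hd : 0 ≤ d)
    (hv : |v| ≤ C * L ^ 3 * lam ^ β * Real.exp (-κ' * d))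
    (hC : 0 ≤ C * L ^ 3) (hB₀ : C * L ^ 3 ≤ θ * B₀) (hrate : κ ≤ κ') :
    |v| ≤ θ * B₀ * lam ^ β * Real.exp (-κ * d) := by
  have hlb : 0 ≤ lam ^ β := Real.rpow_nonneg hlam.le β
  calc |v| ≤ C * L ^ 3 * lam ^ β * Real.exp (-κ' * d) := hv
    _ ≤ C * L ^ 3 * lam ^ β * Real.exp (-κ * d) :=
        mul_le_mul_of_nonneg_left (exp_rate_mono hd hrate) (mul_nonneg hC hlb)
    _ ≤ θ * B₀ * lam ^ β * Real.exp (-κ * d) := by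
        have := mul_le_mul_of_nonneg_right hB₀ (mul_nonneg hlb (Real.exp_pos (-κ * d)).le)
        nlinarith [this]

/-- The printed instance: rate `L(κ−8κ₀−8)` under the rate clause `κ ≤ L(κ−8κ₀−8)`, fraction `¼`.
[cite: Dimock2013BalabanII, §3.18 (arXiv:1212.5562v2 TeX L6341–6344)] -/
theorem new_term_quarter {v C L B₀ β κ κ₀ d lam : ℝ} (hlam : 0 < lam) (hd : 0 ≤ d)
    (hv : |v| ≤ C * L ^ 3 * lam ^ β * Real.exp (-(L * (κ - 8 * κ₀ - 8)) * d))
    (hC : 0 ≤ C * L ^ 3) (hB₀ : C * L ^ 3 ≤ (1 / 4) * B₀) (hrate : κ ≤ L * (κ - 8 * κ₀ - 8)) :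
    |v| ≤ (1 / 4) * B₀ * lam ^ β * Real.exp (-κ * d) :=
  new_term_fraction hlam hd hv hC hB₀ hrate

/-! ## Part 4. The Conclusion: `𝒪(1)λ^{n₀} + θB₀λ^β ≤ B₀λ^β` -/

/-- `λ^{n₀} = λ^{n₀−β} λ^β`. [folklore] -/
theorem rpow_split {lam β n₀ : ℝ} (hlam : 0 < lam) : lam ^ n₀ = lam ^ (n₀ - β) * lam ^ β := by
  rw [← Real.rpow_add hlam]; ring_nf

/-- **THE CONCLUSION STEP** — [Dimock2013BalabanII] §3.18, verbatim: *"|B_{k+1,π⁺}(X)| ≤ (𝒪(1)λ_{k+1}^{n₀} + ½B₀λ_{k+1}^β)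
e^{−κd_M(X, mod Ω^c_{k+1})} ≤ B₀λ_{k+1}^β e^{−κd_M(X, mod Ω^c_{k+1})}"* — PROVED for an arbitrary fraction `θ` in place of
`½`: the second inequality holds as soon as `𝒪(1)·λ^{n₀−β} ≤ (1−θ)B₀`.
[cite: Dimock2013BalabanII, §3.18 Conclusion (arXiv:1212.5562v2 TeX L6427–6428)] -/
theorem conclusion_step {C' B₀ θ β n₀ κ d lam : ℝ} (hlam : 0 < lam)
    (hsmall : C' * lam ^ (n₀ - β) ≤ (1 - θ) * B₀) :
    (C' * lam ^ n₀ + θ * B₀ * lam ^ β) * Real.exp (-κ * d) ≤ B₀ * lam ^ β * Real.exp (-κ * d) := by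
  refine mul_le_mul_of_nonneg_right ?_ (Real.exp_pos _).le
  rw [rpow_split (β := β) hlam]
  have hlb : 0 ≤ lam ^ β := Real.rpow_nonneg hlam.le β
  nlinarith [mul_le_mul_of_nonneg_right hsmall hlb]

/-- *"for λ_k sufficiently small"* in the Conclusion, EXPLICIT: for `0 < λ`, `β < n₀`, `0 < C′`, `0 < (1−θ)B₀` and
`λ ≤ ((1−θ)B₀/C′)^{1/(n₀−β)}` one has `C′λ^{n₀−β} ≤ (1−θ)B₀`. [folklore] -/
theorem lam_small_of_le {C' B₀ θ β n₀ lam : ℝ} (hlam : 0 < lam) (hβn : β < n₀) (hC' : 0 < C')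
    (hgap : 0 < (1 - θ) * B₀) (hle : lam ≤ ((1 - θ) * B₀ / C') ^ (1 / (n₀ - β))) :
    C' * lam ^ (n₀ - β) ≤ (1 - θ) * B₀ := by
  have hexp : 0 < n₀ - β := by linarith
  have hq : 0 < (1 - θ) * B₀ / C' := div_pos hgap hC'
  have h1 : lam ^ (n₀ - β) ≤ (((1 - θ) * B₀ / C') ^ (1 / (n₀ - β))) ^ (n₀ - β) :=
    Real.rpow_le_rpow hlam.le hle hexp.le
  rw [← Real.rpow_mul hq.le, one_div_mul_cancel hexp.ne', Real.rpow_one] at h1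
  calc C' * lam ^ (n₀ - β) ≤ C' * ((1 - θ) * B₀ / C') := mul_le_mul_of_nonneg_left h1 hC'.le
    _ = (1 - θ) * B₀ := mul_div_cancel₀ _ hC'.ne'

/-! ## Part 5. The ledger: all clauses are `k`-free; the assembled reproduction of `B₀` -/

/-- THE LEDGER OF CLAUSES under which `B₀` is reproduced — every entry is a condition on `(L, κ, κ₀, C, C′, B₀, β, n₀,
θ, r, λ_max)` and NONE mentions the step index `k`: `L ≥ 1`; *"B₀ is sufficiently large so that 𝒪(1)L³ ≤ ¼B₀"* as
`C L³ ≤ θ B₀` with the per-piece fraction `θ`, `3θ < 1` (three new pieces, L6300); the rate clause `κ ≤ L(κ − 8κ₀ − 8)`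
(L6112–6113: *"We assume that κ is sufficiently large such that L(κ−8κ₀−8) ≥ κ. (It suffices for example that κ ≥
16κ₀+16)"*, `rate_clause_of_sixteen`);
`r ≥ 2` and `0 ≤ β < n₀`; the survival threshold `−log(Lλ_max) ≥ s₀(n₀−β, log L, log(CL³B₀))` (Part 1); the Conclusion
smallness `C′λ_max^{n₀−β} ≤ (1 − 3θ)B₀` (Part 4); `λ_max > 0`, all couplings of the run satisfying `λ_j ≤ λ_max` (Theorem
3.1: *"let λ_k be sufficiently small (depending on L, M)"*).
[cite: Dimock2013BalabanII, Theorem 3.1 and §3.18 (arXiv:1212.5562v2 TeX L2389, L2497, L6112–6113, L6344, L6427–6428)] -/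
structure Clauses (C C' B₀ L κ κ₀ β n₀ θ lamMax : ℝ) (r : ℕ) : Prop where
  one_le_L : 1 ≤ L
  C_nonneg : 0 ≤ C
  newFrac : C * L ^ 3 ≤ θ * B₀
  three_frac_lt_one : 3 * θ < 1
  rate : κ ≤ L * (κ - 8 * κ₀ - 8)
  two_le_r : 2 ≤ r
  β_nonneg : 0 ≤ β
  β_lt : β < n₀
  lamMax_pos : 0 < lamMax
  survive : sThreshold (n₀ - β) (Real.log L) (Real.log (C * L ^ 3 * B₀)) ≤ -Real.log (L * lamMax)
  conclude : C' * lamMax ^ (n₀ - β) ≤ (1 - 3 * θ) * B₀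

/-- The survival threshold is MONOTONE: if it holds at `λ_max` it holds at every `λ ≤ λ_max`. [folklore] -/
theorem threshold_mono {S L lamMax lam : ℝ} (hL : 0 < L) (hlam : 0 < lam) (hle : lam ≤ lamMax)
    (h : S ≤ -Real.log (L * lamMax)) : S ≤ -Real.log (L * lam) := by
  have : Real.log (L * lam) ≤ Real.log (L * lamMax) :=
    Real.log_le_log (by positivity) (mul_le_mul_of_nonneg_left hle hL.le)
  linarith

/-- The conclusion smallness is MONOTONE in `λ` (for `β ≤ n₀`, `C′ ≥ 0`). [folklore] -/
theorem conclude_mono {C' B θ' β n₀ lamMax lam : ℝ} (hC' : 0 ≤ C') (hlam : 0 < lam) (hle : lam ≤ lamMax)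
    (hβn : β ≤ n₀) (h : C' * lamMax ^ (n₀ - β) ≤ θ' * B) : C' * lam ^ (n₀ - β) ≤ θ' * B :=
  (mul_le_mul_of_nonneg_left (Real.rpow_le_rpow hlam.le hle (by linarith)) hC').trans h

/-- **`B₀` IS REPRODUCED, uniformly in `k`** — the Conclusion of [Dimock2013BalabanII] §3.18 assembled from the printed
per-piece bounds, for an ARBITRARY step (`0 < λ_k ≤ λ_{k+1} ≤ λ_max`, any `k`): with `B_{k+1}(X) = B^{*,(R)}(X) +
(B^{*(0)})′(X) + (B^{*(1)})′(X) + (B^{*(2)})′(X)` (L6422 with L6300, L6410), the tiny piece `|B^{*,(R)}(X)| ≤ 𝒪(1)λ_{k+1}^{n₀}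
e^{−κd}` ((lulu), L6067) and the three NEW boundary pieces, whose printed constants are `B₀`-FREE — `(B^{*(0)})′`: `𝒪(1)L³
λ_{k+1}^β e^{−L(κ−8κ₀−8)d}` (L6341); B^{*,(1)}: `L³λ_k^β e^{−L(κ−κ₀−1)d}` before localization (L6354), *"similar to the
previous case"* (L6348); B^{*,(2)}: `𝒪(1)L³λ_{k+1}^β e^{−2κd}` before localization (L6401, L6404–6405) —, taken here in the
shape `C L³ λ^β e^{−κ_i d}` with any rates `κ_i ≥ κ` (piece (0) at the printed rate via the rate clause; piece (1) with
`λ_k^β`, L6314), the ledger gives **`|B_{k+1}(X)| ≤ B₀ λ_{k+1}^β e^{−κ d(X)}`** with the SAME `B₀`.  (The OLD boundary terms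
enter `B_{k+1}` only through `B^{*,(R)}`, after Lemma 3.17 — `old_term_tiny` — has made them `λ^{n₀}`-small: that is
where `B₀` is NOT inherited.) [cite: Dimock2013BalabanII, §3.18 Conclusion (arXiv:1212.5562v2 TeX L6414–6429)] -/
theorem B0_reproduced {C C' B₀ L κ κ₀ β n₀ θ lamMax : ℝ} {r : ℕ} (hc : Clauses C C' B₀ L κ κ₀ β n₀ θ lamMax r)
    (hC' : 0 ≤ C') {lamk lam1 d bR b0 b1 b2 κ₁ κ₂ : ℝ} (hlamk : 0 < lamk) (hkk1 : lamk ≤ lam1)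
    (hlam1max : lam1 ≤ lamMax) (hd : 0 ≤ d)
    (hbR : |bR| ≤ C' * lam1 ^ n₀ * Real.exp (-κ * d))
    (hb0 : |b0| ≤ C * L ^ 3 * lam1 ^ β * Real.exp (-(L * (κ - 8 * κ₀ - 8)) * d))
    (hb1 : |b1| ≤ C * L ^ 3 * lamk ^ β * Real.exp (-κ₁ * d)) (hκ₁ : κ ≤ κ₁)
    (hb2 : |b2| ≤ C * L ^ 3 * lam1 ^ β * Real.exp (-κ₂ * d)) (hκ₂ : κ ≤ κ₂) :
    |bR + b0 + b1 + b2| ≤ B₀ * lam1 ^ β * Real.exp (-κ * d) := by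
  have hlam1 : 0 < lam1 := lt_of_lt_of_le hlamk hkk1
  have hCL : 0 ≤ C * L ^ 3 := mul_nonneg hc.C_nonneg (pow_nonneg (by linarith [hc.one_le_L]) 3)
  have hb1' : |b1| ≤ C * L ^ 3 * lam1 ^ β * Real.exp (-κ₁ * d) :=
    hb1.trans (mul_le_mul_of_nonneg_right
      (mul_le_mul_of_nonneg_left (rpow_step_mono hlamk hkk1 hc.β_nonneg) hCL) (Real.exp_pos _).le)
  have e0 := new_term_fraction hlam1 hd hb0 hCL hc.newFrac hc.rate
  have e1 := new_term_fraction hlam1 hd hb1' hCL hc.newFrac hκ₁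
  have e2 := new_term_fraction hlam1 hd hb2 hCL hc.newFrac hκ₂
  have hsmall : C' * lam1 ^ (n₀ - β) ≤ (1 - 3 * θ) * B₀ :=
    conclude_mono hC' hlam1 hlam1max hc.β_lt.le hc.conclude
  have hconc := conclusion_step (κ := κ) (d := d) hlam1 hsmall
  calc |bR + b0 + b1 + b2| ≤ |bR| + |b0| + |b1| + |b2| := by
        have := abs_add_le (bR + b0 + b1) b2; have := abs_add_le (bR + b0) b1; have := abs_add_le bR b0
        linarith
    _ ≤ C' * lam1 ^ n₀ * Real.exp (-κ * d) + θ * B₀ * lam1 ^ β * Real.exp (-κ * d)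
          + θ * B₀ * lam1 ^ β * Real.exp (-κ * d) + θ * B₀ * lam1 ^ β * Real.exp (-κ * d) := by linarith
    _ = (C' * lam1 ^ n₀ + (3 * θ) * B₀ * lam1 ^ β) * Real.exp (-κ * d) := by ring
    _ ≤ B₀ * lam1 ^ β * Real.exp (-κ * d) := hconc

/-- The survival clause of the ledger applies at EVERY step: for any `λ_k ≤ λ_max` (so `λ_{k+1} = Lλ_k ≤ Lλ_max`) the
print's `𝒪(1)L³B₀λ_k^β e^{−r_{k+1}} ≤ λ_k^{n₀}` holds.
[cite: Dimock2013BalabanII, §3.13 Lemma 3.17 proof (arXiv:1212.5562v2 TeX L5367)] -/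
theorem survive_every_step {C C' B₀ L κ κ₀ β n₀ θ lamMax : ℝ} {r : ℕ} (hc : Clauses C C' B₀ L κ κ₀ β n₀ θ lamMax r)
    (hC : 0 < C) (hB₀ : 0 < B₀) {lamk : ℝ} (hlamk : 0 < lamk) (hle : lamk ≤ lamMax) :
    C * L ^ 3 * B₀ * lamk ^ β * Real.exp (-rsep r (L * lamk)) ≤ lamk ^ n₀ :=
  survival hc.two_le_r hC hB₀ hc.one_le_L hlamk rfl hc.β_lt.le
    (threshold_mono (by linarith [hc.one_le_L]) hlamk hle hc.survive)

/-- Under the ledger every surviving OLD term at any step is tiny (Part 2 fed by `survive_every_step`).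
[cite: Dimock2013BalabanII, §3.13 Lemma 3.17 (arXiv:1212.5562v2 TeX L5338–5371)] -/
theorem old_term_tiny_every_step {C C' B₀ L κ κ₀ β n₀ θ lamMax : ℝ} {r : ℕ}
    (hc : Clauses C C' B₀ L κ κ₀ β n₀ θ lamMax r) (hC : 0 < C) (hB₀ : 0 < B₀)
    {v d lamk : ℝ} (hlamk : 0 < lamk) (hle : lamk ≤ lamMax) (hd : 0 ≤ d) (hext : rsep r (L * lamk) ≤ d)
    (hv : |v| ≤ C * L ^ 3 * B₀ * lamk ^ β * Real.exp (-(L * (κ - κ₀ - 2)) * d)) :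
    |v| ≤ lamk ^ n₀ * Real.exp (-(L * (κ - κ₀ - 3)) * d) :=
  old_term_tiny hc.one_le_L hlamk hv (by have := hc.C_nonneg; have := hc.one_le_L; positivity) hd hext
    (survive_every_step hc hC hB₀ hlamk hle)

/-- **THE LEDGER IS INHABITED, `k`-free**: for any `𝒪(1)` constants `C > 0`, `C′ ≥ 0`, any `L ≥ 1` and rates with
`κ ≤ L(κ−8κ₀−8)`, exponents `0 ≤ β < n₀`, a per-piece fraction `0 < θ < ⅓` and `r ≥ 2`, the clauses hold with `B₀ := CL³/θ`
(*"B₀ sufficiently large so that 𝒪(1)L³ ≤ ¼B₀"* — *"depending on L, M"*) and the explicit `λ_max := min(e^{−s₀−1}/L,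
((1−3θ)B₀/(C′+1))^{1/(n₀−β)}, ½)` (*"λ_k sufficiently small (depending on L, M)"*).
[cite: Dimock2013BalabanII, Theorem 3.1 (arXiv:1212.5562v2 TeX L2389, L2497)] -/
theorem clauses_inhabited {C C' L κ κ₀ β n₀ θ : ℝ} {r : ℕ} (hC : 0 < C) (hC' : 0 ≤ C') (hL : 1 ≤ L)
    (hrate : κ ≤ L * (κ - 8 * κ₀ - 8)) (hβ : 0 ≤ β) (hβn : β < n₀) (hθ : 0 < θ) (hθ3 : 3 * θ < 1) (hr : 2 ≤ r) :
    ∃ B₀ lamMax : ℝ, 0 < B₀ ∧ Clauses C C' B₀ L κ κ₀ β n₀ θ lamMax r := by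
  have hL0 : 0 < L := by linarith
  set B₀ : ℝ := C * L ^ 3 / θ with hB₀
  have hB₀pos : 0 < B₀ := by positivity
  set s₀ : ℝ := sThreshold (n₀ - β) (Real.log L) (Real.log (C * L ^ 3 * B₀)) with hs₀
  set a : ℝ := Real.exp (-s₀ - 1) / L with ha
  set b : ℝ := ((1 - 3 * θ) * B₀ / (C' + 1)) ^ (1 / (n₀ - β)) with hb
  set lamMax : ℝ := min a (min b (1 / 2)) with hlamMax
  have hapos : 0 < a := by positivity
  have hgap : 0 < (1 - 3 * θ) * B₀ := mul_pos (by linarith) hB₀pos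
  have hq : 0 < (1 - 3 * θ) * B₀ / (C' + 1) := div_pos hgap (by linarith)
  have hbpos : 0 < b := Real.rpow_pos_of_pos hq _
  have hlampos : 0 < lamMax := lt_min hapos (lt_min hbpos (by norm_num))
  have hlam_le_a : lamMax ≤ a := min_le_left _ _
  have hlam_le_b : lamMax ≤ b := (min_le_right _ _).trans (min_le_left _ _)
  refine ⟨B₀, lamMax, hB₀pos, ?_⟩
  have hLa : L * a = Real.exp (-s₀ - 1) := by rw [ha]; field_simp
  have hLlam_le : L * lamMax ≤ Real.exp (-s₀ - 1) := by
    rw [← hLa]; exact mul_le_mul_of_nonneg_left hlam_le_a hL0.le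
  refine
    { one_le_L := hL
      C_nonneg := hC.le
      newFrac := by rw [hB₀]; field_simp; exact le_rfl
      three_frac_lt_one := hθ3
      rate := hrate
      two_le_r := hr
      β_nonneg := hβ
      β_lt := hβn
      lamMax_pos := hlampos
      survive := ?_
      conclude := ?_ }
  · -- s₀ ≤ -log(L lamMax):  log(L lamMax) ≤ log(exp(-s₀-1)) = -s₀-1
    have h1 : Real.log (L * lamMax) ≤ -s₀ - 1 := by
      have := Real.log_le_log (by positivity) hLlam_le
      rwa [Real.log_exp] at this
    show s₀ ≤ -Real.log (L * lamMax)
    linarith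
  · -- C' lamMax^(n₀-β) ≤ (C'+1) b^(n₀-β) = (1-3θ)B₀
    have hexp : 0 < n₀ - β := by linarith
    have hpow : lamMax ^ (n₀ - β) ≤ b ^ (n₀ - β) := Real.rpow_le_rpow hlampos.le hlam_le_b hexp.le
    have hbpow : b ^ (n₀ - β) = (1 - 3 * θ) * B₀ / (C' + 1) := by
      rw [hb, ← Real.rpow_mul hq.le, one_div_mul_cancel hexp.ne', Real.rpow_one]
    calc C' * lamMax ^ (n₀ - β) ≤ (C' + 1) * lamMax ^ (n₀ - β) :=
          mul_le_mul_of_nonneg_right (by linarith) (Real.rpow_nonneg hlampos.le _)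
      _ ≤ (C' + 1) * b ^ (n₀ - β) := mul_le_mul_of_nonneg_left hpow (by linarith)
      _ = (1 - 3 * θ) * B₀ := by rw [hbpow]; field_simp

/-- In print: `θ = ¼` per piece, three pieces, and the Conclusion closes under `𝒪(1)λ_{k+1}^{n₀−β} ≤ ¼B₀ = (1 − 3θ)B₀`.
[cite: Dimock2013BalabanII, §3.18 (arXiv:1212.5562v2 TeX L6344, L6407, L6427–6428)] -/
theorem quarter_fractions : 3 * (1 / 4 : ℝ) < 1 ∧ 1 - 3 * (1 / 4 : ℝ) = 1 / 4 := by norm_num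

/-! ## Part 6. Two located precisions (records only; Dimock-internal) -/

/-- **`r = 1` IS EXCLUDED by the survival clause** (L5367; the same factor `e^{−r_{k+1}} ≤ λ_k^{n₀}·(…)` is taken at L4964,
L5005, L5047, L5069): with `r = 1` one has `e^{−r(λ_{k+1})} = λ_{k+1} = Lλ_k`, so `CL³B₀λ_k^β e^{−r_{k+1}} ≤ λ_k^{n₀}` says
`CL⁴B₀ ≤ λ_k^{n₀−1−β}` — a LOWER bound on the coupling, incompatible with *"λ_k sufficiently small"* since `n₀ ≥ 4 > 1 +
β`.  Hence *"for some postive integer r"* (L1655) is to be read `r ≥ 2` — the case in which L4962's *"e^{−r_{k+1}} = 𝒪(λ_k^n)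
for any n"* holds (`exp_neg_rsep_le_rpow`).  Records only; immaterial to the paper's results.
[cite: Dimock2013BalabanII, §3.1.1 and §3.13 (arXiv:1212.5562v2 TeX L1653–1655, L4962, L5367)] -/
theorem r_one_forces_lower_bound {C B₀ L β n₀ lamk : ℝ} (hL : 0 < L) (hlamk : 0 < lamk)
    (h : C * L ^ 3 * B₀ * lamk ^ β * Real.exp (-rsep 1 (L * lamk)) ≤ lamk ^ n₀) :
    C * L ^ 4 * B₀ ≤ lamk ^ (n₀ - 1 - β) := by
  have hpos : 0 < L * lamk := by positivity
  rw [exp_neg_rsep_one hpos] at h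
  -- h : C L³ B₀ λ^β (L λ) ≤ λ^{n₀}; divide by λ^{β+1} > 0
  have hsplit : lamk ^ n₀ = lamk ^ (n₀ - 1 - β) * (lamk ^ β * lamk) := by
    rw [← Real.rpow_add_one hlamk.ne', ← Real.rpow_add hlamk]; ring_nf
  have hq : 0 < lamk ^ β * lamk := mul_pos (Real.rpow_pos_of_pos hlamk β) hlamk
  rw [hsplit] at h
  have h' : (C * L ^ 4 * B₀) * (lamk ^ β * lamk) ≤ lamk ^ (n₀ - 1 - β) * (lamk ^ β * lamk) := by
    calc (C * L ^ 4 * B₀) * (lamk ^ β * lamk) = C * L ^ 3 * B₀ * lamk ^ β * (L * lamk) := by ring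
      _ ≤ lamk ^ (n₀ - 1 - β) * (lamk ^ β * lamk) := h
  exact le_of_mul_le_mul_right h' hq

/-- With `r = 1` the clause CANNOT hold for all small couplings: if `n₀ > 1 + β` and `CL⁴B₀ > 0`, some admissible
`λ_k` violates it (take `λ_k` below `(CL⁴B₀)^{1/(n₀−1−β)}` and below `1`). [folklore] -/
theorem r_one_fails_for_small {C B₀ L β n₀ : ℝ} (hL : 1 ≤ L) (hK : 0 < C * L ^ 4 * B₀) (hn : 1 + β < n₀) :
    ∃ lamk : ℝ, 0 < lamk ∧ L * lamk < 1 ∧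
      ¬ (C * L ^ 3 * B₀ * lamk ^ β * Real.exp (-rsep 1 (L * lamk)) ≤ lamk ^ n₀) := by
  have hL0 : 0 < L := by linarith
  have hexp : 0 < n₀ - 1 - β := by linarith
  -- choose lamk with lamk^(n₀-1-β) < C L⁴ B₀ and L lamk < 1
  set q : ℝ := (C * L ^ 4 * B₀ / 2) ^ (1 / (n₀ - 1 - β)) with hq
  have hqpos : 0 < q := Real.rpow_pos_of_pos (by positivity) _
  set lamk : ℝ := min q (1 / (2 * L)) with hlamk
  have hlampos : 0 < lamk := lt_min hqpos (by positivity)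
  have hlam_le_q : lamk ≤ q := min_le_left _ _
  have hLlam : L * lamk < 1 := by
    have : lamk ≤ 1 / (2 * L) := min_le_right _ _
    calc L * lamk ≤ L * (1 / (2 * L)) := mul_le_mul_of_nonneg_left this hL0.le
      _ = 1 / 2 := by field_simp
      _ < 1 := by norm_num
  refine ⟨lamk, hlampos, hLlam, fun h => ?_⟩
  have hlow := r_one_forces_lower_bound hL0 hlampos h
  have hqpow : q ^ (n₀ - 1 - β) = C * L ^ 4 * B₀ / 2 := by
    rw [hq, ← Real.rpow_mul (by positivity), one_div_mul_cancel hexp.ne', Real.rpow_one]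
  have hup : lamk ^ (n₀ - 1 - β) ≤ C * L ^ 4 * B₀ / 2 := by
    rw [← hqpow]; exact Real.rpow_le_rpow hlampos.le hlam_le_q hexp.le
  linarith

/-- **THE FRACTIONS** (records only): the print bounds `(B^{*(0)})′` and `(B^{*(2)})′` by `¼B₀` each (L6342, L6407) and
treats `(B^{*(1)})′` *"similar to the previous case"* (L6348) — three quarters in all —, while (lulu2) (L6289) and the
first member of the Conclusion (L6427) carry `½B₀`.  The reproduction is unaffected in substance: with `θ = ¾` the
Conclusion closes under `𝒪(1)λ_{k+1}^{n₀−β} ≤ ¼B₀` (still `k`-free), or with the print's `½` if each piece is taken at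
`⅙B₀` (`B₀ ≥ 6·𝒪(1)L³`).  Records only.
[cite: Dimock2013BalabanII, §3.18 (arXiv:1212.5562v2 TeX L6289, L6342, L6348, L6407, L6427)] -/
theorem conclusion_three_quarters {C' B₀ β n₀ κ d lam : ℝ} (hlam : 0 < lam)
    (hsmall : C' * lam ^ (n₀ - β) ≤ (1 / 4) * B₀) :
    (C' * lam ^ n₀ + (3 / 4) * B₀ * lam ^ β) * Real.exp (-κ * d) ≤ B₀ * lam ^ β * Real.exp (-κ * d) :=
  conclusion_step hlam (θ := 3 / 4) (by linarith)

/-- The print's own fractions read literally: `½` for the sum needs each of the three pieces at `⅙` — `6·𝒪(1)L³ ≤ B₀`.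
[cite: Dimock2013BalabanII, §3.18 (arXiv:1212.5562v2 TeX L6289, L6344)] -/
theorem sixth_fractions {C L B₀ : ℝ} (h : 6 * (C * L ^ 3) ≤ B₀) :
    C * L ^ 3 ≤ (1 / 6) * B₀ ∧ (1 / 6 : ℝ) + 1 / 6 + 1 / 6 = 1 / 2 := ⟨by linarith, by norm_num⟩

/-! ## Part 7 (v1.1). Contrast: the TINY terms are kept tiny by the coupling-RATIO device (L6112–6119) -/

/-- The rate clause's printed sufficient condition — [Dimock2013BalabanII] §3.18, verbatim: *"We assume that κ is
sufficiently large such that L(κ−8κ₀−8) ≥ κ. (It suffices for example that κ ≥ 16κ₀+16)."* — PROVED for `L ≥ 2`, `κ₀ ≥ 0`.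
[cite: Dimock2013BalabanII, §3.18 (arXiv:1212.5562v2 TeX L6112–6113)] -/
theorem rate_clause_of_sixteen {L κ κ₀ : ℝ} (hL : 2 ≤ L) (hκ₀ : 0 ≤ κ₀) (h : 16 * κ₀ + 16 ≤ κ) :
    κ ≤ L * (κ - 8 * κ₀ - 8) := by
  nlinarith

/-- The printed identity *"𝒪(1)L³λ_k^{n₀} = 𝒪(1)L^{3−n₀}λ_{k+1}^{n₀}"* for `λ_{k+1} = Lλ_k` — a POWER of the coupling
ratio `λ_k/λ_{k+1} = L^{−1}`. [cite: Dimock2013BalabanII, §3.18 (arXiv:1212.5562v2 TeX L6116)] -/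
theorem tiny_term_scaling {C L n₀ lamk lamk1 : ℝ} (hL : 0 < L) (hlamk : 0 < lamk) (hstep : lamk1 = L * lamk) :
    C * L ^ 3 * lamk ^ n₀ = C * L ^ (3 - n₀) * lamk1 ^ n₀ := by
  have h3 : (L ^ 3 : ℝ) = L ^ (3 : ℝ) := by norm_cast
  have hLn : L ^ n₀ ≠ 0 := (Real.rpow_pos_of_pos hL _).ne'
  have key : L ^ (3 : ℝ) / L ^ n₀ * (L ^ n₀ * lamk ^ n₀) = L ^ (3 : ℝ) * lamk ^ n₀ := by
    field_simp
  calc C * L ^ 3 * lamk ^ n₀ = C * (L ^ (3 : ℝ) * lamk ^ n₀) := by rw [h3]; ring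
    _ = C * (L ^ (3 : ℝ) / L ^ n₀ * (L ^ n₀ * lamk ^ n₀)) := by rw [key]
    _ = C * L ^ (3 - n₀) * lamk1 ^ n₀ := by rw [hstep, Real.mul_rpow hL.le hlamk.le, Real.rpow_sub hL]; ring

/-- **THE TINY-TERM DEVICE** — [Dimock2013BalabanII] §3.18, verbatim: *"Furthermore for L sufficiently large and n₀ ≥ 4
𝒪(1)L³λ_k^{n₀} = 𝒪(1)L^{3−n₀}λ_{k+1}^{n₀} ≤ ⅙λ_{k+1}^{n₀}  This is why we chose n₀ ≥ 4. This is the basic mechanism which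
keeps the tiny terms tiny, in spite of the growth factor L³."* — PROVED with *"L sufficiently large"* EXPLICIT as `6C ≤
L^{n₀−3}` (inhabited for `n₀ > 3`, e.g. `n₀ ≥ 4` and `L ≥ 6C`).  CONTRAST with Parts 2–5: this absorption of the growth
factor IS a power `L^{3−n₀} = (λ_k/λ_{k+1})^{n₀−3}` of the coupling ratio (superrenormalizability: `λ_k = L^{−(N−k)}λ`),
whereas the boundary-term ledger uses the ratio only additively and monotonically (cell TEMPLATE.md §14.6 T-G16).
[cite: Dimock2013BalabanII, §3.18 (arXiv:1212.5562v2 TeX L6114–6119)] -/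
theorem tiny_term_sixth {C L n₀ lamk lamk1 : ℝ} (hL : 0 < L) (hlamk : 0 < lamk) (hstep : lamk1 = L * lamk)
    (hbig : 6 * C ≤ L ^ (n₀ - 3)) : C * L ^ 3 * lamk ^ n₀ ≤ (1 / 6) * lamk1 ^ n₀ := by
  have hlamk1 : 0 < lamk1 := by rw [hstep]; positivity
  have hpow : 0 < lamk1 ^ n₀ := Real.rpow_pos_of_pos hlamk1 n₀
  rw [tiny_term_scaling hL hlamk hstep]
  -- C L^{3-n₀} ≤ 1/6  ⇔  6C ≤ L^{n₀-3}
  have hinv : L ^ (3 - n₀) = (L ^ (n₀ - 3))⁻¹ := by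
    rw [← Real.rpow_neg hL.le]; ring_nf
  have hLp : 0 < L ^ (n₀ - 3) := Real.rpow_pos_of_pos hL _
  have hCL : C * L ^ (3 - n₀) ≤ 1 / 6 := by
    rw [hinv, ← div_eq_mul_inv, div_le_iff₀ hLp]
    linarith
  calc C * L ^ (3 - n₀) * lamk1 ^ n₀ ≤ (1 / 6) * lamk1 ^ n₀ := mul_le_mul_of_nonneg_right hCL hpow.le

/-- *"L sufficiently large"* for the device, EXPLICIT and `k`-free: for `n₀ ≥ 4` and `L ≥ max(1, 6C)` one has
`6C ≤ L ≤ L^{n₀−3}`. [cite: Dimock2013BalabanII, §3.18 (arXiv:1212.5562v2 TeX L6114–6118)] -/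
theorem tiny_term_L_large {C L n₀ : ℝ} (hn : 4 ≤ n₀) (hL1 : 1 ≤ L) (hL : 6 * C ≤ L) :
    6 * C ≤ L ^ (n₀ - 3) := by
  have h1 : L ^ (1:ℝ) ≤ L ^ (n₀ - 3) := Real.rpow_le_rpow_of_exponent_le hL1 (by linarith)
  rw [Real.rpow_one] at h1
  linarith

end Literature.MathematicalPhysics.QuantumFieldTheory.Dimock2011to13.BoundaryTermLedger
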